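import Summits.QuantumFields.YangMills.Theorems.BalabanLadderIRTorusUpgrade
import HarnessLib

/-!
# `IR` — algebra of typical classes: intersections keep cell-locality and ADD single-cell rarity budgets

Spine route `BalabanLadder` (route-QuantumFields-BalabanLadder), crux `IR` (stmt-QuantumFields-19354), registered line
«af-pincer-T» (skeleton 0308f95ca6f6a115).  The owner's recommended typical class is a finite INTERSECTION of
components (R37 (b): `Typ = Typ_bulk ∩ Typ_sheet [∩ Typ_dilute]`; R47: `Typ_flow ∩ Typ_bulk`), each with its own
single-cell sup-`ζ` rarity budget.  This small file records the bookkeeping the lead needs to feed such a composite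
class into the landed upgrades (`IRRarityUpgrade.collarJointRarity_of_supCellRarity` = clause (ii_T),
`torusJointRarity_of_supCellRarity` = clause (iii_T)): the two `TypShellCond` conjuncts (measurable, cell-local) are
stable under finite intersections, single-cell rarity is MONOTONE in the class and SUBADDITIVE under intersection
(`supCellRarity_biInter`: budgets add over a `Finset` of components), and the composite clauses (ii_T)/(iii_T) follow
with the summed budget (`collarJointRarity_biInter`, `torusJointRarity_biInter`).
Count-neutral helper (`--supports stmt-QuantumFields-19354 --as helper`); no stub claimed, no skeleton touched.
Everything here is proved (no `sorry`, no new axioms).  HONEST FRAMING: pure bookkeeping; the component rarity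
estimates, (i_T) and the bridge carry the weight; conditional chain untouched; not a gap, not Clay.
-/

set_option autoImplicit false

noncomputable section

open MeasureTheory
open scoped ENNReal
open Literature.Probability.LatticeModels
open Literature.MathematicalPhysics.QuantumLattice
open Literature.MathematicalPhysics.QuantumFieldTheory (GaugeConfig wilsonMeasure)
open Summit.QuantumFields.YangMills.Cruxes.IR.Tempered (cellEdges regionEdges)

namespace Summit.QuantumFields.YangMills.Theorems.IRRarityUpgrade

/-! ## §1 Abstract: measurability, cell-locality and rarity budgets of intersections -/

section Abstract

variable {Ω V C ι : Type*} [MeasurableSpace Ω]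

omit [MeasurableSpace Ω] in
/-- Cell-locality is stable under binary intersection. -/
theorem dependsOn_mem_inter {S : Set V} {A B : Set (V → Ω)}
    (hA : DependsOn (fun σ : V → Ω => σ ∈ A) S) (hB : DependsOn (fun σ : V → Ω => σ ∈ B) S) :
    DependsOn (fun σ : V → Ω => σ ∈ A ∩ B) S := fun σ τ h => by
  simp only [Set.mem_inter_iff, eq_iff_iff]
  rw [show (σ ∈ A) = (τ ∈ A) from hA h, show (σ ∈ B) = (τ ∈ B) from hB h]

omit [MeasurableSpace Ω] in
/-- Cell-locality is stable under finite intersections. -/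
theorem dependsOn_mem_biInter {S : Set V} (I : Finset ι) {A : ι → Set (V → Ω)}
    (hA : ∀ i ∈ I, DependsOn (fun σ : V → Ω => σ ∈ A i) S) :
    DependsOn (fun σ : V → Ω => σ ∈ ⋂ i ∈ I, A i) S := fun σ τ h => by
  simp only [Set.mem_iInter, eq_iff_iff]
  exact forall₂_congr fun i hi => by rw [show (σ ∈ A i) = (τ ∈ A i) from hA i hi h]

/-- The complement of a finite intersection has mass at most the sum of the complements' masses. -/
theorem measure_compl_biInter_le (μ : Measure Ω) (I : Finset ι) (A : ι → Set Ω) :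
    μ (⋂ i ∈ I, A i)ᶜ ≤ ∑ i ∈ I, μ (A i)ᶜ := by
  classical
  rw [Set.compl_iInter₂]
  exact measure_biUnion_finset_le I fun i => (A i)ᶜ

/-- `ofReal` is subadditive over finite sums of nonnegative reals (equality, in fact). -/
theorem sum_ofReal_eq (I : Finset ι) {δ : ι → ℝ} (hδ : ∀ i ∈ I, 0 ≤ δ i) :
    ∑ i ∈ I, ENNReal.ofReal (δ i) = ENNReal.ofReal (∑ i ∈ I, δ i) :=
  (ENNReal.ofReal_sum_of_nonneg hδ).symm

end Abstract

/-! ## §2 Single-cell rarity: monotone in the class, subadditive under intersection -/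

section YangMills

variable {G : Type} [Group G] [TopologicalSpace G] [IsTopologicalGroup G] [CompactSpace G]
  [MeasurableSpace G] [BorelSpace G] {N : ℕ} (ρ : G →* Matrix (Fin N) (Fin N) ℂ)

/-- **Monotonicity.**  A larger class is at least as typical: single-cell rarity transfers from `Typ` to any
`Typ' ⊇ Typ` with the same budget. -/
theorem supCellRarity_mono (β : ℝ) {w : Fin 4 → ℤ → ℤ} {Typ Typ' : (Fin 4 → ℤ) → Set (LGConfig 4 G)}
    (hsub : ∀ c, Typ c ⊆ Typ' c) {δ : ℝ}
    (h1 : ∀ (c : Fin 4 → ℤ) (ζ : LGConfig 4 G), (ymSpecification ρ β (regionEdges w {c}) ζ) (Typ c)ᶜ ≤ ENNReal.ofReal δ)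
    (c : Fin 4 → ℤ) (ζ : LGConfig 4 G) :
    (ymSpecification ρ β (regionEdges w {c}) ζ) (Typ' c)ᶜ ≤ ENNReal.ofReal δ :=
  (measure_mono (Set.compl_subset_compl.2 (hsub c))).trans (h1 c ζ)

/-- **Subadditivity under finite intersection.**  If each component `Typ i` (`i ∈ I`) has single-cell sup-`ζ` rarity
with budget `δ i ≥ 0`, the composite class `c ↦ ⋂ i ∈ I, Typ i c` has single-cell rarity with budget `Σ i ∈ I, δ i`. -/
theorem supCellRarity_biInter (β : ℝ) {w : Fin 4 → ℤ → ℤ} {ι : Type*} (I : Finset ι)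
    {Typ : ι → (Fin 4 → ℤ) → Set (LGConfig 4 G)} {δ : ι → ℝ} (hδ : ∀ i ∈ I, 0 ≤ δ i)
    (h1 : ∀ i ∈ I, ∀ (c : Fin 4 → ℤ) (ζ : LGConfig 4 G),
      (ymSpecification ρ β (regionEdges w {c}) ζ) (Typ i c)ᶜ ≤ ENNReal.ofReal (δ i))
    (c : Fin 4 → ℤ) (ζ : LGConfig 4 G) :
    (ymSpecification ρ β (regionEdges w {c}) ζ) (⋂ i ∈ I, Typ i c)ᶜ ≤ ENNReal.ofReal (∑ i ∈ I, δ i) := by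
  refine (measure_compl_biInter_le _ I fun i => Typ i c).trans ?_
  rw [← sum_ofReal_eq I hδ]
  exact Finset.sum_le_sum fun i hi => h1 i hi c ζ

variable [SecondCountableTopology G]

/-- **Clause (iii_T) for a composite class** (finite intersection of cell-local measurable components, each with a
single-cell rarity budget): the torus anchor with the SUMMED budget. -/
theorem torusJointRarity_biInter (hρ : Continuous ρ) (β : ℝ) {b : ℕ} (hb : 1 ≤ b) {w : Fin 4 → ℤ → ℤ}
    (hw : ∀ i j, w i j + ((b : ℕ) : ℤ) ≤ w i (j + 1) ∧ w i (j + 1) ≤ w i j + 2 * ((b : ℕ) : ℤ))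
    {ι : Type*} (I : Finset ι) {Typ : ι → (Fin 4 → ℤ) → Set (LGConfig 4 G)}
    (hTm : ∀ i ∈ I, ∀ c, MeasurableSet (Typ i c))
    (hTd : ∀ i ∈ I, ∀ c, DependsOn (fun σ : LGConfig 4 G => σ ∈ Typ i c) ↑(cellEdges w c))
    {δ : ι → ℝ} (hδ : ∀ i ∈ I, 0 ≤ δ i)
    (h1 : ∀ i ∈ I, ∀ (c : Fin 4 → ℤ) (ζ : LGConfig 4 G),
      (ymSpecification ρ β (regionEdges w {c}) ζ) (Typ i c)ᶜ ≤ ENNReal.ofReal (δ i)) :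
    ∀ S : ℕ, 4 * b ≤ 2 * S + 1 → ∀ F : Finset (Fin 4 → ℤ), F.Nonempty →
      (∀ c ∈ F, ∀ i, -(S : ℤ) ≤ w i (c i) ∧ w i (c i + 1) ≤ (S : ℤ) + 1) →
        (wilsonMeasure (d := 4) (L := 2 * S + 1) ρ β)
            {V : GaugeConfig 4 (2 * S + 1) G | ∀ c ∈ F, torusLift (2 * S + 1) V ∉ ⋂ i ∈ I, Typ i c} ≤
          ENNReal.ofReal ((∑ i ∈ I, δ i) ^ F.card) :=
  torusJointRarity_of_supCellRarity ρ hρ β hb hw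
    (fun c => Finset.measurableSet_biInter I fun i hi => hTm i hi c)
    (fun c => dependsOn_mem_biInter I fun i hi => hTd i hi c)
    (Finset.sum_nonneg hδ) (supCellRarity_biInter ρ β I hδ h1)

variable [T2Space G]

/-- **Clause (ii_T) for a composite class**: hereditary joint rarity under the kernels with the SUMMED budget. -/
theorem collarJointRarity_biInter (hρ : Continuous ρ) (β : ℝ) {b : ℕ} {w : Fin 4 → ℤ → ℤ}
    (hw : ∀ i j, w i j + ((b : ℕ) : ℤ) ≤ w i (j + 1) ∧ w i (j + 1) ≤ w i j + 2 * ((b : ℕ) : ℤ))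
    {ι : Type*} (I : Finset ι) {Typ : ι → (Fin 4 → ℤ) → Set (LGConfig 4 G)}
    (hTm : ∀ i ∈ I, ∀ c, MeasurableSet (Typ i c))
    (hTd : ∀ i ∈ I, ∀ c, DependsOn (fun σ : LGConfig 4 G => σ ∈ Typ i c) ↑(cellEdges w c))
    {δ : ι → ℝ} (hδ : ∀ i ∈ I, 0 ≤ δ i)
    (h1 : ∀ i ∈ I, ∀ (c : Fin 4 → ℤ) (ζ : LGConfig 4 G),
      (ymSpecification ρ β (regionEdges w {c}) ζ) (Typ i c)ᶜ ≤ ENNReal.ofReal (δ i)) :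
    ∀ F F' : Finset (Fin 4 → ℤ), F ⊆ F' → F.Nonempty → ∀ ζ : LGConfig 4 G,
      (∀ c' : Fin 4 → ℤ, c' ∉ F' → (∃ c ∈ F', ∀ i, |c' i - c i| ≤ 1) → ζ ∈ ⋂ i ∈ I, Typ i c') →
        (ymSpecification ρ β (regionEdges w F') ζ) {σ : LGConfig 4 G | ∀ c ∈ F, σ ∉ ⋂ i ∈ I, Typ i c} ≤
          ENNReal.ofReal ((∑ i ∈ I, δ i) ^ F.card) :=
  collarJointRarity_of_supCellRarity ρ hρ β hw
    (fun c => Finset.measurableSet_biInter I fun i hi => hTm i hi c)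
    (fun c => dependsOn_mem_biInter I fun i hi => hTd i hi c)
    (Finset.sum_nonneg hδ) (supCellRarity_biInter ρ β I hδ h1)

end YangMills

end Summit.QuantumFields.YangMills.Theorems.IRRarityUpgrade

end
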